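import Mathlib
import Summits.Ventures.PercRepro2.Defs
import Summits.Ventures.PercRepro2.Graph
import Summits.Ventures.PercRepro2.Harris
import Summits.Ventures.PercRepro2.CDQuasiConcave

/-!
# Row 2′C1 from its single-edge cross term — the one-edge reduction
(blind cell PercRepro2, p2 g33; proofs/P2-G33-CROSS.md §2)

Row 2′C1 for the weight vector `p` (`Q = {a₁ ↮ a₂}`, `H = C(a₂)`, `U = C(a₁) ∪ C(a₂)`):

  `c1Slack p = P(Q) · P(Q, o ∈ U, b ∈ U) − P(Q, b ∈ H) · P(Q, o ∈ U) ≥ 0`.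

Every probability is affine in each edge weight (the pinning identity `prob_eq_pin`), so for an
edge `e`, with `p[e↦c]` the weight vector with `e` pinned to `c`,

  `c1Slack p = (1 − p e)² · c1Slack p[e↦0] + (p e)² · c1Slack p[e↦1] + p e (1 − p e) · c1Cross p e`

(`c1Slack_eq_pin`), where the **single-edge cross term** is

  `c1Cross p e = P⁰(Q) P¹(Q oU bU) + P¹(Q) P⁰(Q oU bU) − P⁰(Q bH) P¹(Q oU) − P¹(Q bH) P⁰(Q oU)`

(`P⁰ = P_{p[e↦0]}`, `P¹ = P_{p[e↦1]}`).  THE REDUCTION (`c1Slack_nonneg_of_cross`, `c1_of_cross`):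
if every weight vector with a fractional edge has a fractional edge whose cross term is
nonnegative (`CrossNonneg`, a CANDIDATE of this seat: `c1Cross p e ≥ 0` for EVERY edge on
288 / 288 edges of all eleven edge types locally and 0 violations in the kit smoke tests; the
scale census is kit j333650), then row 2′C1 holds for every admissible weight vector — strong
induction on the number of fractional edges (`CDQC.fracEdges`); the fully pinned base is a point
mass (`CDQC.prob_mul_prob_pinned`) where the row reads `P(oU ∩ bU ∩ Q) ≥ P(bH ∩ oU ∩ Q)`.
Std axioms.
-/

namespace Summit.Ventures.PercRepro2

namespace RowC1

section Cross

variable {V : Type*} {E : Type*} [Fintype E] [DecidableEq E] [Fintype V] [DecidableEq V]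
  {R : Type*} [Field R] [LinearOrder R] [IsStrictOrderedRing R]

/-- The slack of row 2′C1 for the weight vector `p`:
`P(Q) · P(Q, o ∈ U, b ∈ U) − P(Q, b ∈ H) · P(Q, o ∈ U)` (the cleared form of `c1_of_star`). -/
noncomputable def c1Slack (p : E → R) (ends : E → Sym2 V) (a₁ a₂ o b : V) : R :=
  prob p (connEvent ends a₁ a₂)ᶜ *
      prob p ((connEvent ends a₁ o ∪ connEvent ends a₂ o) ∩
        (connEvent ends a₁ b ∪ connEvent ends a₂ b) ∩ (connEvent ends a₁ a₂)ᶜ) -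
    prob p (connEvent ends a₂ b ∩ (connEvent ends a₁ a₂)ᶜ) *
      prob p ((connEvent ends a₁ o ∪ connEvent ends a₂ o) ∩ (connEvent ends a₁ a₂)ᶜ)

/-- The **single-edge cross term** of row 2′C1 at the edge `e`:
`P⁰(Q) P¹(Q oU bU) + P¹(Q) P⁰(Q oU bU) − P⁰(Q bH) P¹(Q oU) − P¹(Q bH) P⁰(Q oU)`
with `P⁰ / P¹` the measures with `e` pinned closed / open. -/
noncomputable def c1Cross (p : E → R) (ends : E → Sym2 V) (a₁ a₂ o b : V) (e : E) : R :=
  prob (Function.update p e (0 : R)) (connEvent ends a₁ a₂)ᶜ *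
      prob (Function.update p e (1 : R)) ((connEvent ends a₁ o ∪ connEvent ends a₂ o) ∩
        (connEvent ends a₁ b ∪ connEvent ends a₂ b) ∩ (connEvent ends a₁ a₂)ᶜ) +
    prob (Function.update p e (1 : R)) (connEvent ends a₁ a₂)ᶜ *
      prob (Function.update p e (0 : R)) ((connEvent ends a₁ o ∪ connEvent ends a₂ o) ∩
        (connEvent ends a₁ b ∪ connEvent ends a₂ b) ∩ (connEvent ends a₁ a₂)ᶜ) -
    prob (Function.update p e (0 : R)) (connEvent ends a₂ b ∩ (connEvent ends a₁ a₂)ᶜ) *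
      prob (Function.update p e (1 : R))
        ((connEvent ends a₁ o ∪ connEvent ends a₂ o) ∩ (connEvent ends a₁ a₂)ᶜ) -
    prob (Function.update p e (1 : R)) (connEvent ends a₂ b ∩ (connEvent ends a₁ a₂)ᶜ) *
      prob (Function.update p e (0 : R))
        ((connEvent ends a₁ o ∪ connEvent ends a₂ o) ∩ (connEvent ends a₁ a₂)ᶜ)

omit [Fintype V] [DecidableEq V] [LinearOrder R] [IsStrictOrderedRing R] in
/-- **The one-edge expansion of the row**: `c1Slack p = (1 − p e)² c1Slack p[e↦0] +
(p e)² c1Slack p[e↦1] + p e (1 − p e) c1Cross p e` (the pinning identity for each of the four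
masses, then a ring identity). -/
theorem c1Slack_eq_pin (p : E → R) (ends : E → Sym2 V) (a₁ a₂ o b : V) (e : E) :
    c1Slack p ends a₁ a₂ o b =
      (1 - p e) ^ 2 * c1Slack (Function.update p e (0 : R)) ends a₁ a₂ o b +
        (p e) ^ 2 * c1Slack (Function.update p e (1 : R)) ends a₁ a₂ o b +
        p e * (1 - p e) * c1Cross p ends a₁ a₂ o b e := by
  unfold c1Slack c1Cross
  rw [prob_eq_pin p (connEvent ends a₁ a₂)ᶜ e,
    prob_eq_pin p ((connEvent ends a₁ o ∪ connEvent ends a₂ o) ∩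
      (connEvent ends a₁ b ∪ connEvent ends a₂ b) ∩ (connEvent ends a₁ a₂)ᶜ) e,
    prob_eq_pin p (connEvent ends a₂ b ∩ (connEvent ends a₁ a₂)ᶜ) e,
    prob_eq_pin p ((connEvent ends a₁ o ∪ connEvent ends a₂ o) ∩ (connEvent ends a₁ a₂)ᶜ) e]
  ring

omit [Fintype E] [DecidableEq E] [Fintype V] [DecidableEq V] [LinearOrder R]
  [IsStrictOrderedRing R] in
/-- `{b ∈ H} ∩ {o ∈ U} ∩ Q ⊆ Q ∩ ({o ∈ U} ∩ {b ∈ U} ∩ Q)` (a connection `b ↔ a₂` is a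
connection `b ↔ a₁ ∨ b ↔ a₂`). -/
lemma bHQ_inter_oUQ_subset (ends : E → Sym2 V) (a₁ a₂ o b : V) :
    connEvent ends a₂ b ∩ (connEvent ends a₁ a₂)ᶜ ∩
        ((connEvent ends a₁ o ∪ connEvent ends a₂ o) ∩ (connEvent ends a₁ a₂)ᶜ) ⊆
      (connEvent ends a₁ a₂)ᶜ ∩ ((connEvent ends a₁ o ∪ connEvent ends a₂ o) ∩
        (connEvent ends a₁ b ∪ connEvent ends a₂ b) ∩ (connEvent ends a₁ a₂)ᶜ) := by
  rintro ω ⟨⟨hbH, hQ⟩, ⟨hoU, _⟩⟩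
  exact ⟨hQ, ⟨⟨hoU, Or.inr hbH⟩, hQ⟩⟩

omit [Fintype V] [DecidableEq V] in
/-- **The fully pinned base**: when every weight is `0` or `1` the measure is a point mass and
the row's slack is `P(oU ∩ bU ∩ Q) − P(bH ∩ oU ∩ Q) ≥ 0`. -/
lemma c1Slack_nonneg_of_pinned (p : E → R) (hp : IsProbVec p) (hq : ∀ f, p f = 0 ∨ p f = 1)
    (ends : E → Sym2 V) (a₁ a₂ o b : V) : 0 ≤ c1Slack p ends a₁ a₂ o b := by
  unfold c1Slack
  rw [CDQC.prob_mul_prob_pinned p hq, CDQC.prob_mul_prob_pinned p hq, sub_nonneg]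
  exact prob_mono hp (bHQ_inter_oUQ_subset ends a₁ a₂ o b)

/-- **`CrossNonneg`** (a CANDIDATE of p2 g33): every admissible weight vector with a fractional
edge has a fractional edge whose single-edge cross term is nonnegative.  (The census says more:
`c1Cross p e ≥ 0` for EVERY edge `e`.) -/
def CrossNonneg (ends : E → Sym2 V) (a₁ a₂ o b : V) : Prop :=
  ∀ p : E → R, IsProbVec p → (∃ e, p e ≠ 0 ∧ p e ≠ 1) →
    ∃ e, p e ≠ 0 ∧ p e ≠ 1 ∧ 0 ≤ c1Cross p ends a₁ a₂ o b e

omit [DecidableEq E] [Fintype V] [DecidableEq V] [IsStrictOrderedRing R] in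
/-- Membership in `CDQC.fracEdges` is «neither `0` nor `1`». -/
lemma mem_fracEdges_iff (p : E → R) (e : E) :
    e ∈ CDQC.fracEdges p ↔ p e ≠ 0 ∧ p e ≠ 1 := by
  simp only [CDQC.fracEdges, Finset.mem_filter, Finset.mem_univ, true_and, not_or]

omit [Fintype V] [DecidableEq V] in
/-- **THE REDUCTION**: `CrossNonneg` implies row 2′C1 for every admissible weight vector
(strong induction on the number of fractional edges; the fully pinned base is
`c1Slack_nonneg_of_pinned`). -/
theorem c1Slack_nonneg_of_cross (ends : E → Sym2 V) (a₁ a₂ o b : V)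
    (hC : CrossNonneg (R := R) ends a₁ a₂ o b) :
    ∀ p : E → R, IsProbVec p → 0 ≤ c1Slack p ends a₁ a₂ o b := by
  intro p hp
  generalize hn : (CDQC.fracEdges p).card = n
  induction n using Nat.strong_induction_on generalizing p with
  | _ n ih =>
    by_cases h0 : CDQC.fracEdges p = ∅
    · -- base: every edge is pinned
      have hq : ∀ f, p f = 0 ∨ p f = 1 := by
        intro f
        by_contra hcon
        have : f ∈ CDQC.fracEdges p := (mem_fracEdges_iff p f).2 (not_or.1 hcon)
        rw [h0] at this
        exact absurd this (Finset.notMem_empty f)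
      exact c1Slack_nonneg_of_pinned p hp hq ends a₁ a₂ o b
    · -- step: a fractional edge `e` with a nonnegative cross term
      obtain ⟨g, hg⟩ := Finset.nonempty_iff_ne_empty.mpr h0
      obtain ⟨e, he0, he1, hcross⟩ := hC p hp ⟨g, (mem_fracEdges_iff p g).1 hg⟩
      have he : e ∈ CDQC.fracEdges p := (mem_fracEdges_iff p e).2 ⟨he0, he1⟩
      have hpos : 0 < n := by
        rw [← hn]
        exact Finset.card_pos.mpr ⟨e, he⟩
      have hc1 : (CDQC.fracEdges (Function.update p e (1 : R))).card = n - 1 := by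
        rw [CDQC.card_fracEdges_update p he (Or.inr rfl), hn]
      have hc0 : (CDQC.fracEdges (Function.update p e (0 : R))).card = n - 1 := by
        rw [CDQC.card_fracEdges_update p he (Or.inl rfl), hn]
      have h1 : 0 ≤ c1Slack (Function.update p e (1 : R)) ends a₁ a₂ o b :=
        ih (n - 1) (Nat.sub_lt hpos Nat.one_pos) (Function.update p e 1)
          (hp.update e zero_le_one le_rfl) hc1
      have h0' : 0 ≤ c1Slack (Function.update p e (0 : R)) ends a₁ a₂ o b :=
        ih (n - 1) (Nat.sub_lt hpos Nat.one_pos) (Function.update p e 0)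
          (hp.update e le_rfl zero_le_one) hc0
      rw [c1Slack_eq_pin p ends a₁ a₂ o b e]
      have hpe0 : 0 ≤ p e := hp.nonneg e
      have hpe1 : 0 ≤ 1 - p e := sub_nonneg.2 (hp.le_one e)
      have t1 : 0 ≤ (1 - p e) ^ 2 * c1Slack (Function.update p e (0 : R)) ends a₁ a₂ o b :=
        mul_nonneg (sq_nonneg _) h0'
      have t2 : 0 ≤ (p e) ^ 2 * c1Slack (Function.update p e (1 : R)) ends a₁ a₂ o b :=
        mul_nonneg (sq_nonneg _) h1
      have t3 : 0 ≤ p e * (1 - p e) * c1Cross p ends a₁ a₂ o b e :=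
        mul_nonneg (mul_nonneg hpe0 hpe1) hcross
      linarith

omit [Fintype V] [DecidableEq V] in
/-- **Row 2′C1 from `CrossNonneg`**, in the form of `c1_of_star`:
`P(Q, b ∈ H) · P(Q, o ∈ U) ≤ P(Q) · P(Q, o ∈ U, b ∈ U)`. -/
theorem c1_of_cross (ends : E → Sym2 V) (a₁ a₂ o b : V)
    (hC : CrossNonneg (R := R) ends a₁ a₂ o b) (p : E → R) (hp : IsProbVec p) :
    prob p (connEvent ends a₂ b ∩ (connEvent ends a₁ a₂)ᶜ) *
      prob p ((connEvent ends a₁ o ∪ connEvent ends a₂ o) ∩ (connEvent ends a₁ a₂)ᶜ) ≤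
    prob p (connEvent ends a₁ a₂)ᶜ *
      prob p ((connEvent ends a₁ o ∪ connEvent ends a₂ o) ∩
        (connEvent ends a₁ b ∪ connEvent ends a₂ b) ∩ (connEvent ends a₁ a₂)ᶜ) := by
  have h := c1Slack_nonneg_of_cross ends a₁ a₂ o b hC p hp
  unfold c1Slack at h
  linarith

end Cross

end RowC1

end Summit.Ventures.PercRepro2
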